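import Literature.Topology.FourManifolds.PairSaddleRegions
import Mathlib.Topology.Order.MonotoneConvergence
import HarnessLib

/-!
# Passages through the saddle boxes of a pair, and the agreement of the saddle pieces

Topic `Literature/Topology/FourManifolds` (support file for the two-field handle-extension
endgame of `stmt-SmoothPoincare4-15190`, after `PairSaddleRegions.lean`,
`MilnorBoxFlowLines.lean`).  Everything here is **proved**; no definitions.

Milnor, *Lectures on the h-cobordism theorem* (1965), proofs of Thms. 3.12–3.13 (PDF
pp. 18–19).  For saddle data `Q : P.SaddleData` of a pair of basin settings and a saddle `s`
(box `DA s` of size `ε`, value `c`), the `ξ_A`-trajectories through the `3ε`-ball are the model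
hyperbolas, whence (`MilnorBoxFlowLines.lean`):

* **exit from a small ball** (`exists_exit_of_mem_chartBall`): a point of the `ρ`-ball
  (`ρ ≤ ε`) off the stable disc reaches the level `c + ε²` forward, inside the `3ε`-ball, at a
  point with `|x⃗|² ≤ ρ⁴ / (4ε²)`; **entrance** symmetrically (`exists_entrance_of_mem_chartBall`);
  **exit from the entrance discs** (`exists_exit_of_mem_Uent`): a point of the entrance discs of
  width `δ ≤ ε²` off the stable disc exits through the exit annulus of width `2δ`;
* along each such passage the model conjugation `MC s` conjugates the two flows (`MC_θ`);
* points **on** the stable disc never meet a level `> c`, points on the unstable disc never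
  meet a level `< c` (`not_hits_of_sqSumGE_eq_zero`, `not_hits_of_sqSumLT_eq_zero`).

Consequently the pieces of the extension map agree on the overlaps of their domains
(`PairLevelTransport.LT_eq_LT_of_exists_θ`): **the entrance and exit transports of `s` agree**
(`LT_refEnt_eq_LT_refExit`), and **both agree with `MC s` on a small ball**
(`LT_refExit_eq_MC`, `LT_refEnt_eq_MC`).

## References

* J. Milnor, *Lectures on the h-cobordism theorem* (1965), Def. 3.1, proofs of Thms. 3.12–3.13
  (PDF pp. 12, 17–19). [MilnorHCobordism1965]
* H. B. Griffiths, *Automorphisms of a 3-dimensional handlebody*, Abh. Math. Sem. Univ. Hamburg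
  26 (1964), §§3–6. [GriffithsHB1964Handlebody]
-/

open scoped Manifold ContDiff Topology
open Set Function Filter Metric

noncomputable section

namespace Literature.Topology.FourManifolds

open Cobordism FourManifolds.Flow

universe u

variable {n : ℕ} {W : Type u} [TopologicalSpace W] [T2Space W] [SecondCountableTopology W]
  [CompactSpace W] [ChartedSpace (EuclideanHalfSpace (n + 1)) W] [IsManifold (𝓡∂ (n + 1)) ∞ W]

/-- `Q_k(u) ≤ ‖u‖²` (local helper). [folklore] -/
private theorem milnorQuadratic_le_norm_sq' {m : ℕ} (k : ℕ) (u : EuclideanSpace ℝ (Fin m)) :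
    milnorQuadratic k u ≤ ‖u‖ ^ 2 := by
  rw [milnorQuadratic_eq, ← sqSumLT_add_sqSumGE k u]; linarith [sqSumLT_nonneg k u]

/-- `-‖u‖² ≤ Q_k(u)` (local helper). [folklore] -/
private theorem neg_norm_sq_le_milnorQuadratic' {m : ℕ} (k : ℕ) (u : EuclideanSpace ℝ (Fin m)) :
    -‖u‖ ^ 2 ≤ milnorQuadratic k u := by
  rw [milnorQuadratic_eq, ← sqSumLT_add_sqSumGE k u]; linarith [sqSumGE_nonneg k u]

/-- `|x⃗|² |y⃗|² ≤ ‖u‖⁴ / 4` (local helper). [folklore] -/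
private theorem sqSumLT_mul_sqSumGE_le' {m : ℕ} (k : ℕ) (u : EuclideanSpace ℝ (Fin m)) :
    sqSumLT k u * sqSumGE k u ≤ ‖u‖ ^ 4 / 4 := by
  have h := sqSumLT_add_sqSumGE k u
  nlinarith [sq_nonneg (sqSumLT k u - sqSumGE k u)]

namespace BasinPair

variable {g : W → ℝ} {ξA ξB : Π x : W, TangentSpace (𝓡∂ (n + 1)) x}

/-- The `ξ_A`-level point of `x` is any point of its orbit on that level (W-typed, pair form). [folklore] -/
theorem levelProj_A_eq_θ (P : BasinPair g ξA ξB) {x : W} (hx : ¬ IsMCriticalPt (𝓡∂ (n + 1)) g x) {ℓ : ℝ}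
    (hℓ : ℓ ∈ Ioo (g P.A.p₀) P.A.hi) {t : ℝ} (ht : g (P.A.θ (t, x)) = ℓ) : levelProj P.A.θ g ℓ x = P.A.θ (t, x) :=
  P.A.levelProj_eq_θ_of_apply_eq hx (P.A.Ioo_subset_slab hℓ) ht

namespace SaddleData

variable {P : BasinPair g ξA ξB} (Q : P.SaddleData)

/-! ### Levels in the boxes -/

/-- The level of a point of the `3ε`-ball of `DA s`: `g z = c + Q(coord z)`. [cite: MilnorHCobordism1965, Def. 3.1 (2) (PDF p. 12)] -/
theorem apply_eq_of_mem_chartBall {s : SaddlePt n g} {z : W} (hz : z ∈ (Q.DA s).chartBall (3 * Q.ε)) :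
    g z = Q.c + milnorQuadratic (Q.DA s).k ((Q.DA s).coord z) := Q.apply_eq_A s hz.1

/-- Points of the `ρ`-ball, `ρ ≤ ε`, have level in `[c - ρ², c + ρ²]`. [folklore] -/
theorem abs_apply_sub_c_le_of_mem_chartBall {s : SaddlePt n g} {ρ : ℝ} {z : W} (hz : z ∈ (Q.DA s).chartBall ρ) :
    |g z - Q.c| ≤ ρ ^ 2 := by
  have h0 : 0 ≤ ρ := (norm_nonneg _).trans hz.2.le
  rw [Q.apply_eq_A s hz.1, add_sub_cancel_left, abs_le]
  have h1 := milnorQuadratic_le_norm_sq' (Q.DA s).k ((Q.DA s).coord z)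
  have h2 := neg_norm_sq_le_milnorQuadratic' (Q.DA s).k ((Q.DA s).coord z)
  have h3 : ‖(Q.DA s).coord z‖ ^ 2 ≤ ρ ^ 2 := pow_le_pow_left₀ (norm_nonneg _) hz.2.le 2
  constructor <;> linarith

/-! ### Points on the stable and unstable discs do not cross the far levels -/

/-- **A point of the `3ε`-ball on the stable disc (`y⃗ = 0`) never meets a level `> c`**: its
forward orbit converges to the saddle, so all its levels are `≤ c`. [cite: MilnorHCobordism1965, proof of Thm. 3.12 (PDF p. 18)] -/
theorem not_hits_of_sqSumGE_eq_zero {s : SaddlePt n g} {z : W} (hz : z ∈ (Q.DA s).chartBall (3 * Q.ε))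
    (hb : sqSumGE (Q.DA s).k ((Q.DA s).coord z) = 0) {ℓ : ℝ} (hℓ : Q.c < ℓ) : ¬ Hits P.A.θ g ℓ z := by
  rintro ⟨t, ht⟩
  have hwc := milnorModelField_eq_neg_of_sqSumGE_eq_zero hb
  have hconv : Tendsto (fun τ => P.A.θ (τ, z)) atTop (𝓝 s.1) := by
    have h := (Q.DA s).tendsto_flow_symm_add P.A.isSmoothFlow_X P.A.contMDiff_X hwc (by rw [Q.εA]; exact hz.2)
    have hz' : (Q.DA s).pt ((Q.DA s).coord z) = z := (Q.DA s).pt_coord_of_mem_chartBall hz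
    rw [MilnorBox.pt] at hz'
    rwa [hz'] at h
  have hgc : Continuous g := P.A.isMorseFunction.isMorse.contMDiff.continuous
  have hlim : Tendsto (fun τ => g (P.A.θ (τ, z))) atTop (𝓝 Q.c) := by
    rw [← Q.apply_eq_c s]; exact (hgc.tendsto _).comp hconv
  have hle : g (P.A.θ (t, z)) ≤ Q.c := (P.A.monotone_apply_θ z).ge_of_tendsto hlim t
  rw [ht] at hle
  linarith

/-- **A point of the chart domain on the unstable disc (`x⃗ = 0`, `|y⃗|² ≤ 4ε²`) never meets a
level `< c`**: its backward orbit converges to the saddle. [cite: MilnorHCobordism1965, proof of Thm. 3.12 (PDF p. 18)] -/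
theorem not_hits_of_sqSumLT_eq_zero {s : SaddlePt n g} {z : W} (hz : z ∈ (Q.DA s).chart.source)
    (ha : sqSumLT (Q.DA s).k ((Q.DA s).coord z) = 0) (hb : sqSumGE (Q.DA s).k ((Q.DA s).coord z) ≤ 4 * Q.ε ^ 2)
    {ℓ : ℝ} (hℓ : ℓ < Q.c) : ¬ Hits P.A.θ g ℓ z := by
  rintro ⟨t, ht⟩
  have hconv : Tendsto (fun τ => P.A.θ (τ, z)) atBot (𝓝 s.1) :=
    (Q.DA s).tendsto_atBot_of_sqSumLT_eq_zero P.A.isFlowOf_X hz ha (by rw [Q.εA]; exact hb)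
  have hgc : Continuous g := P.A.isMorseFunction.isMorse.contMDiff.continuous
  have hlim : Tendsto (fun τ => g (P.A.θ (τ, z))) atBot (𝓝 Q.c) := by
    rw [← Q.apply_eq_c s]; exact (hgc.tendsto _).comp hconv
  have hle : Q.c ≤ g (P.A.θ (t, z)) := (P.A.monotone_apply_θ z).le_of_tendsto hlim t
  rw [ht] at hle
  linarith

/-! ### Exits and entrances -/

/-- **Exit from a small ball.**  A point `x` of the `ρ`-ball of `DA s` (`ρ ≤ ε`) with `y⃗ ≠ 0`
reaches the level `c + ε²` at a forward time `t`, inside the `3ε`-ball, with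
`|x⃗|²(θ_A (t, x)) ≤ ρ⁴ / (4ε²)`, and `MC s (θ_A (t, x)) = θ_B (t, MC s x)`. [cite: MilnorHCobordism1965, proof of Thm. 3.12 (PDF p. 18)] -/
theorem exists_exit_of_mem_chartBall {s : SaddlePt n g} {ρ : ℝ} (hρ : ρ ≤ Q.ε) {x : W}
    (hx : x ∈ (Q.DA s).chartBall ρ) (hb : 0 < sqSumGE (Q.DA s).k ((Q.DA s).coord x)) :
    ∃ t, 0 ≤ t ∧ g (P.A.θ (t, x)) = Q.c + Q.ε ^ 2 ∧
      sqSumLT (Q.DA s).k ((Q.DA s).coord (P.A.θ (t, x))) ≤ ρ ^ 4 / (4 * Q.ε ^ 2) ∧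
      (∀ τ ∈ Icc 0 t, P.A.θ (τ, x) ∈ (Q.DA s).chartBall (3 * Q.ε)) ∧
      Q.MC s (P.A.θ (t, x)) = P.B.θ (t, Q.MC s x) := by
  set D := Q.DA s with hD
  set u := D.coord x with hu
  have hε := Q.ε_pos
  have hρ0 : 0 ≤ ρ := (norm_nonneg _).trans hx.2.le
  have hx3 : x ∈ D.chartBall (3 * D.ε) := ⟨hx.1, by rw [Q.εA]; linarith [hx.2]⟩
  have hun : ‖u‖ < ρ := hx.2
  have hu2 : ‖u‖ ^ 2 ≤ ρ ^ 2 := pow_le_pow_left₀ (norm_nonneg _) hun.le 2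
  have hab : sqSumLT D.k u * sqSumGE D.k u ≤ ρ ^ 4 / 4 := by
    have h := sqSumLT_mul_sqSumGE_le' D.k u
    have h4 : ‖u‖ ^ 4 ≤ ρ ^ 4 := pow_le_pow_left₀ (norm_nonneg _) hun.le 4
    linarith
  have hL : milnorQuadratic D.k u ≤ Q.ε ^ 2 :=
    (milnorQuadratic_le_norm_sq' D.k u).trans (hu2.trans (pow_le_pow_left₀ hρ0 hρ 2))
  have hroom : Q.ε ^ 2 + 2 * (sqSumLT D.k u * sqSumGE D.k u / Q.ε ^ 2) < (3 * D.ε) ^ 2 := by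
    rw [Q.εA]
    have h1 : sqSumLT D.k u * sqSumGE D.k u / Q.ε ^ 2 ≤ Q.ε ^ 2 / 4 := by
      rw [div_le_iff₀ (pow_pos hε 2)]
      have h4 : ρ ^ 4 ≤ Q.ε ^ 4 := pow_le_pow_left₀ hρ0 hρ 4
      nlinarith
    nlinarith
  obtain ⟨t, ht0, htL, hA, hpass⟩ := D.exists_exit_level P.A.isSmoothFlow_X P.A.contMDiff_X hx3 hb Q.sq_pos hL hroom
  have hpass' : ∀ τ ∈ Icc 0 t, P.A.θ (τ, x) ∈ D.chartBall (3 * Q.ε) := fun τ hτ => by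
    have h := (hpass τ hτ).1; rwa [Q.εA] at h
  refine ⟨t, ht0, ?_, ?_, hpass', ?_⟩
  · rw [htL, Q.apply_eq_c s]
  · refine hA.trans ?_
    rw [div_le_div_iff₀ (pow_pos hε 2) (by positivity)]
    nlinarith [pow_pos hε 2]
  · exact Q.MC_θ le_rfl ht0 hpass' ⟨ht0, le_rfl⟩

/-- **Entrance into a small ball.**  A point `x` of the `ρ`-ball of `DA s` (`ρ ≤ ε`) with `x⃗ ≠ 0`
comes from the level `c - ε²` at a backward time `t`, inside the `3ε`-ball, with
`|y⃗|²(θ_A (t, x)) ≤ ρ⁴ / (4ε²)`, and `MC s (θ_A (t, x)) = θ_B (t, MC s x)`. [cite: MilnorHCobordism1965, proof of Thm. 3.12 (PDF p. 18)] -/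
theorem exists_entrance_of_mem_chartBall {s : SaddlePt n g} {ρ : ℝ} (hρ : ρ ≤ Q.ε) {x : W}
    (hx : x ∈ (Q.DA s).chartBall ρ) (ha : 0 < sqSumLT (Q.DA s).k ((Q.DA s).coord x)) :
    ∃ t, t ≤ 0 ∧ g (P.A.θ (t, x)) = Q.c - Q.ε ^ 2 ∧
      sqSumGE (Q.DA s).k ((Q.DA s).coord (P.A.θ (t, x))) ≤ ρ ^ 4 / (4 * Q.ε ^ 2) ∧
      (∀ τ ∈ Icc t 0, P.A.θ (τ, x) ∈ (Q.DA s).chartBall (3 * Q.ε)) ∧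
      Q.MC s (P.A.θ (t, x)) = P.B.θ (t, Q.MC s x) := by
  set D := Q.DA s with hD
  set u := D.coord x with hu
  have hε := Q.ε_pos
  have hρ0 : 0 ≤ ρ := (norm_nonneg _).trans hx.2.le
  have hx3 : x ∈ D.chartBall (3 * D.ε) := ⟨hx.1, by rw [Q.εA]; linarith [hx.2]⟩
  have hun : ‖u‖ < ρ := hx.2
  have hu2 : ‖u‖ ^ 2 ≤ ρ ^ 2 := pow_le_pow_left₀ (norm_nonneg _) hun.le 2
  have hab : sqSumLT D.k u * sqSumGE D.k u ≤ ρ ^ 4 / 4 := by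
    have h := sqSumLT_mul_sqSumGE_le' D.k u
    have h4 : ‖u‖ ^ 4 ≤ ρ ^ 4 := pow_le_pow_left₀ (norm_nonneg _) hun.le 4
    linarith
  have hL : -Q.ε ^ 2 ≤ milnorQuadratic D.k u := by
    have h1 := neg_norm_sq_le_milnorQuadratic' D.k u
    have h2 : ρ ^ 2 ≤ Q.ε ^ 2 := pow_le_pow_left₀ hρ0 hρ 2
    linarith
  have hroom : Q.ε ^ 2 + 2 * (sqSumLT D.k u * sqSumGE D.k u / Q.ε ^ 2) < (3 * D.ε) ^ 2 := by
    rw [Q.εA]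
    have h1 : sqSumLT D.k u * sqSumGE D.k u / Q.ε ^ 2 ≤ Q.ε ^ 2 / 4 := by
      rw [div_le_iff₀ (pow_pos hε 2)]
      have h4 : ρ ^ 4 ≤ Q.ε ^ 4 := pow_le_pow_left₀ hρ0 hρ 4
      nlinarith
    nlinarith
  obtain ⟨t, ht0, htL, hB, hpass⟩ := D.exists_entrance_level P.A.isSmoothFlow_X P.A.contMDiff_X hx3 ha Q.sq_pos hL hroom
  have hpass' : ∀ τ ∈ Icc t 0, P.A.θ (τ, x) ∈ D.chartBall (3 * Q.ε) := fun τ hτ => by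
    have h := (hpass τ hτ).1; rwa [Q.εA] at h
  refine ⟨t, ht0, ?_, ?_, hpass', ?_⟩
  · rw [htL, Q.apply_eq_c s]
  · refine hB.trans ?_
    rw [div_le_div_iff₀ (pow_pos hε 2) (by positivity)]
    nlinarith [pow_pos hε 2]
  · exact Q.MC_θ ht0 le_rfl hpass' ⟨le_rfl, ht0⟩

/-- **Exit from the entrance discs.**  A point `w` of the entrance discs of width `δ ≤ ε²` at the
level `c - ε²`, off the stable disc, exits at a forward time `t` through the level `c + ε²`,
inside the `3ε`-ball, with `|x⃗|²(θ_A (t, w)) < 2δ`, and `MC s (θ_A (t, w)) = θ_B (t, MC s w)`. [cite: MilnorHCobordism1965, proof of Thm. 3.12 (PDF p. 18)] -/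
theorem exists_exit_of_mem_Uent {s : SaddlePt n g} {δ : ℝ} (hδ : δ ≤ Q.ε ^ 2) {w : W} (hw : w ∈ Q.Uent s δ)
    (hwℓ : g w = Q.c - Q.ε ^ 2) (hb : 0 < sqSumGE (Q.DA s).k ((Q.DA s).coord w)) :
    ∃ t, 0 ≤ t ∧ g (P.A.θ (t, w)) = Q.c + Q.ε ^ 2 ∧
      sqSumLT (Q.DA s).k ((Q.DA s).coord (P.A.θ (t, w))) < 2 * δ ∧
      (∀ τ ∈ Icc 0 t, P.A.θ (τ, w) ∈ (Q.DA s).chartBall (3 * Q.ε)) ∧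
      Q.MC s (P.A.θ (t, w)) = P.B.θ (t, Q.MC s w) := by
  set D := Q.DA s with hD
  set u := D.coord w with hu
  have hε := Q.ε_pos
  have hw3 : w ∈ D.chartBall (3 * D.ε) := by rw [Q.εA]; exact hw.1
  -- `|x⃗|² = ε² + |y⃗|²` on the level `c - ε²`
  have hQ : milnorQuadratic D.k u = -Q.ε ^ 2 := by
    have h := Q.apply_eq_of_mem_chartBall hw.1; rw [hwℓ] at h; linarith
  have haeq : sqSumLT D.k u = Q.ε ^ 2 + sqSumGE D.k u := by rw [milnorQuadratic_eq] at hQ; linarith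
  have hbδ : sqSumGE D.k u < δ := hw.2
  have hab : sqSumLT D.k u * sqSumGE D.k u / Q.ε ^ 2 ≤ 2 * sqSumGE D.k u := by
    rw [div_le_iff₀ (pow_pos hε 2), haeq]
    have : sqSumGE D.k u ≤ Q.ε ^ 2 := by linarith
    nlinarith [hb.le]
  have hL : milnorQuadratic D.k u ≤ Q.ε ^ 2 := by rw [hQ]; linarith [pow_pos hε 2]
  have hroom : Q.ε ^ 2 + 2 * (sqSumLT D.k u * sqSumGE D.k u / Q.ε ^ 2) < (3 * D.ε) ^ 2 := by
    rw [Q.εA]; nlinarith [pow_pos hε 2]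
  obtain ⟨t, ht0, htL, hA, hpass⟩ := D.exists_exit_level P.A.isSmoothFlow_X P.A.contMDiff_X hw3 hb Q.sq_pos hL hroom
  have hpass' : ∀ τ ∈ Icc 0 t, P.A.θ (τ, w) ∈ D.chartBall (3 * Q.ε) := fun τ hτ => by
    have h := (hpass τ hτ).1; rwa [Q.εA] at h
  refine ⟨t, ht0, ?_, ?_, hpass', ?_⟩
  · rw [htL, Q.apply_eq_c s]
  · exact hA.trans_lt (hab.trans_lt (by linarith))
  · exact Q.MC_θ le_rfl ht0 hpass' ⟨ht0, le_rfl⟩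

/-! ### Agreement of the pieces -/

/-- **The entrance and exit transports of a saddle agree on the overlap of their domains**
(`δ ≤ ε²` for the entrance width): the two reference points of `x` are joined by a passage
through the `3ε`-ball along which `MC s` conjugates the flows. [cite: MilnorHCobordism1965, proof of Thm. 3.13 (PDF pp. 18–19)] [cite: GriffithsHB1964Handlebody, §§3–6] -/
theorem LT_refEnt_eq_LT_refExit {s : SaddlePt n g} {δ δ' : ℝ} (hδ : δ ≤ Q.ε ^ 2) {x : W}
    (hx₃ : x ∈ (Q.refEnt s δ).dom) (hx₂ : x ∈ (Q.refExit s δ').dom) :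
    (Q.refEnt s δ).LT x = (Q.refExit s δ').LT x := by
  set w := (Q.refEnt s δ).ref x with hw
  have hwU : w ∈ Q.Uent s δ := RefData.ref_mem_U hx₃
  have hwℓ : g w = Q.c - Q.ε ^ 2 := RefData.apply_ref hx₃
  -- `w` is off the stable disc, since `x` meets the level `c + ε²`
  have hb : 0 < sqSumGE (Q.DA s).k ((Q.DA s).coord w) := by
    refine lt_of_le_of_ne (sqSumGE_nonneg _ _) fun h0 => ?_
    have hnot := Q.not_hits_of_sqSumGE_eq_zero hwU.1 h0.symm (lt_add_of_pos_right _ Q.sq_pos)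
    rw [hw, RefData.ref_def, refEnt_ℓ₀, P.A.hits_levelProj_iff] at hnot
    exact hnot hx₂.2.2.1
  obtain ⟨t, ht0, htℓ, -, -, hMC⟩ := Q.exists_exit_of_mem_Uent hδ hwU hwℓ hb
  -- the exit point is the reference point of the exit piece
  have href₂ : (Q.refExit s δ').ref x = P.A.θ (t, w) := by
    rw [RefData.ref_def, refExit_ℓ₀]
    have h1 : P.A.θ (t, w) = P.A.θ (t + hittingTime P.A.θ g (Q.c - Q.ε ^ 2) x, x) := by
      rw [← P.A.θ_add]; rfl
    rw [h1] at htℓ ⊢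
    exact P.levelProj_A_eq_θ hx₂.2.1 ⟨Q.apply_p₀_lt_c.trans (lt_add_of_pos_right _ Q.sq_pos), Q.c_add_sq_lt_hi⟩ htℓ
  refine RefData.LT_eq_LT_of_exists_θ hx₃ hx₂ ⟨t, ?_⟩
  show P.B.θ (t, Q.MC s w) = Q.MC s ((Q.refExit s δ').ref x)
  rw [href₂, hMC]

/-- **The exit transport agrees with `MC s` on the `ρ`-ball** (`ρ ≤ ε`). [cite: MilnorHCobordism1965, proof of Thm. 3.13 (PDF pp. 18–19)] -/
theorem LT_refExit_eq_MC {s : SaddlePt n g} {δ ρ : ℝ} (hρ : ρ ≤ Q.ε) {x : W}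
    (hxb : x ∈ (Q.DA s).chartBall ρ) (hx₂ : x ∈ (Q.refExit s δ).dom) : (Q.refExit s δ).LT x = Q.MC s x := by
  have hx3 : x ∈ (Q.DA s).chartBall (3 * Q.ε) := ⟨hxb.1, by linarith [hxb.2, Q.ε_pos]⟩
  have hb : 0 < sqSumGE (Q.DA s).k ((Q.DA s).coord x) := by
    refine lt_of_le_of_ne (sqSumGE_nonneg _ _) fun h0 => ?_
    exact Q.not_hits_of_sqSumGE_eq_zero hx3 h0.symm (lt_add_of_pos_right _ Q.sq_pos) hx₂.2.2.1
  obtain ⟨t, -, htℓ, -, -, hMC⟩ := Q.exists_exit_of_mem_chartBall hρ hxb hb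
  have href : (Q.refExit s δ).ref x = P.A.θ (t, x) := by
    rw [RefData.ref_def, refExit_ℓ₀]
    exact P.levelProj_A_eq_θ hx₂.2.1 ⟨Q.apply_p₀_lt_c.trans (lt_add_of_pos_right _ Q.sq_pos), Q.c_add_sq_lt_hi⟩ htℓ
  refine RefData.LT_eq_of_exists_θ hx₂ ⟨-t, ?_⟩ (Q.apply_MC hx3.1 hx3.2.le)
  show P.B.θ (-t, Q.MC s ((Q.refExit s δ).ref x)) = Q.MC s x
  rw [href, hMC, P.B.θ_add, neg_add_cancel, P.B.θ_zero]

/-- **The entrance transport agrees with `MC s` on the `ρ`-ball** (`ρ ≤ ε`). [cite: MilnorHCobordism1965, proof of Thm. 3.13 (PDF pp. 18–19)] -/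
theorem LT_refEnt_eq_MC {s : SaddlePt n g} {δ ρ : ℝ} (hρ : ρ ≤ Q.ε) {x : W}
    (hxb : x ∈ (Q.DA s).chartBall ρ) (hx₃ : x ∈ (Q.refEnt s δ).dom) : (Q.refEnt s δ).LT x = Q.MC s x := by
  have hx3 : x ∈ (Q.DA s).chartBall (3 * Q.ε) := ⟨hxb.1, by linarith [hxb.2, Q.ε_pos]⟩
  have ha : 0 < sqSumLT (Q.DA s).k ((Q.DA s).coord x) := by
    refine lt_of_le_of_ne (sqSumLT_nonneg _ _) fun h0 => ?_
    have hB : sqSumGE (Q.DA s).k ((Q.DA s).coord x) ≤ 4 * Q.ε ^ 2 := by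
      have h1 := sqSumLT_add_sqSumGE (Q.DA s).k ((Q.DA s).coord x)
      have h2 : ‖(Q.DA s).coord x‖ ^ 2 ≤ Q.ε ^ 2 :=
        (pow_le_pow_left₀ (norm_nonneg _) hxb.2.le 2).trans (pow_le_pow_left₀ ((norm_nonneg _).trans hxb.2.le) hρ 2)
      nlinarith [sqSumLT_nonneg (Q.DA s).k ((Q.DA s).coord x), pow_pos Q.ε_pos 2]
    exact Q.not_hits_of_sqSumLT_eq_zero hxb.1 h0.symm hB (sub_lt_self _ Q.sq_pos) hx₃.2.2.1
  obtain ⟨t, -, htℓ, -, -, hMC⟩ := Q.exists_entrance_of_mem_chartBall hρ hxb ha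
  have href : (Q.refEnt s δ).ref x = P.A.θ (t, x) := by
    rw [RefData.ref_def, refEnt_ℓ₀]
    exact P.levelProj_A_eq_θ hx₃.2.1 ⟨Q.apply_p₀_lt_c_sub_sq, (sub_lt_self _ Q.sq_pos).trans Q.c_lt_hi⟩ htℓ
  refine RefData.LT_eq_of_exists_θ hx₃ ⟨-t, ?_⟩ (Q.apply_MC hx3.1 hx3.2.le)
  show P.B.θ (-t, Q.MC s ((Q.refEnt s δ).ref x)) = Q.MC s x
  rw [href, hMC, P.B.θ_add, neg_add_cancel, P.B.θ_zero]

end SaddleData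

end BasinPair

end Literature.Topology.FourManifolds
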